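import Summits.CriticalPhenomena.PercolationContinuityZ3.Theorems.PercNearOneGluingNoHeavyLowerTailFourPointPendantSideGluing
import HarnessLib

/-!
# Four-point cells when one terminal's side hangs off a non-terminal cut vertex, II: dictionaries, the pendant weight `θ`, and the fifteen cells

Support file for crux `stmt-CriticalPhenomena-4575` (master-family programme; Conjecture W = row `Q44` ∀n and every other four-point row), seat `prim-l12-p6` gen 29;
sequel of `…FourPointPendantSideGluing` (`IsPendantSplit.cell_eq_sum`).
* `IsPendantSplit.real_sideA_eq` / `real_sideR_eq` — the side dictionaries (pattern events of the five marked points under `w₁` / `w₂`);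
* `IsPendantSplit.sideA_sum` — `μ_{w₁}(a ↮ v) + μ_{w₁}(a ↔ v) = 1`; `IsPendantSplit.sideR_eq_cell` — **`μ_{w₂}(atom pmark (sideR j)) = cell w₂ v b c y j`** (the far-side law IS
  the four-point law of `(v,b,c,y)` in the far piece);
* `IsPendantSplit.cell0 … cell14` — **THE PENDANT SUBSTITUTION**: with `θ = μ_{w₁}(atom pmark (sideA 1)) = P_side(a ↔ v)` and `d_k = cell w₂ v b c y k`,
  `cell w a b c y k = (1−θ)·(D_a d)_k + θ·d_k`, written as `μ_{w₁}(a ↮ v)·(Σ_{j : a split off j = k} d_j) + θ·d_k`: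
  `c₀ = A₀(d₀+d₄+d₅+d₆) + θd₀`, `c₁ = A₀(d₁+d₁₀+d₁₁) + θd₁`, `c₂ = A₀(d₂+d₉+d₁₂) + θd₂`, `c₃ = A₀(d₃+d₈+d₁₃) + θd₃`, `c₇ = A₀(d₇+d₁₄) + θd₇`, and `c_k = θ d_k` otherwise
  (`A₀ = μ_{w₁}(atom pmark (sideA 0)) = 1 − θ`).
Consumer: `…Q44PendantSide` (Conjecture W at a (3,1) cut vertex).  No definitions, no named facts, no sorries, standard axioms.
[cite: Grimmett1999, §2.2 (independence of disjoint edge sets)]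
-/

noncomputable section

namespace Summit.CriticalPhenomena.PercolationContinuityZ3.Theorems

namespace FourPointPendantSide

open MeasureTheory Set Literature.Probability.LatticeModels Literature.Probability.Percolation
open FourPointAtoms
open Summit.CriticalPhenomena.PercolationContinuityZ3.Cruxes.AdditiveGluing.TieLine.ConnAtoms
open scoped Classical

variable {n : ℕ}

namespace IsPendantSplit

variable {D₁ D₂ : Finset (Sym2 (Fin n))} {w w₁ w₂ : Sym2 (Fin n) → unitInterval} {a b c y v : Fin n}

/-! ## The side dictionaries -/

/-- **Side-`a` dictionary**: under `w₁` every pattern event of the five marked points has measure `Σ_i [Φ (sideA i)] μ_{w₁}(atom pmark (sideA i))`. [this work] -/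
theorem real_sideA_eq (h : IsPendantSplit D₁ D₂ w w₁ w₂ a b c y v) {E : Set (BondConfig (Fin n))} {Φ : (Fin 5 → Fin 5) → Prop}
    [DecidablePred Φ] (hE : HasPattern (pmark a b c y v) E Φ) :
    (prodBernoulli w₁).real E = ∑ i : Fin 2, if Φ (sideA i) then (prodBernoulli w₁).real (atom (pmark a b c y v) (sideA i)) else 0 := by
  classical
  have hae := prodBernoulli_ae_forall_notMem w₁ (Z := (↑D₁ : Set (Sym2 (Fin n)))ᶜ) (Set.to_countable _)
    (fun e he => h.left_zero e (fun h' => he (Finset.mem_coe.2 h')))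
  have hcongr : (E : Set (BondConfig (Fin n))) =ᵐ[prodBernoulli w₁]
      (⋃ i ∈ (Finset.univ.filter fun i : Fin 2 => Φ (sideA i)), atom (pmark a b c y v) (sideA i) : Set (BondConfig (Fin n))) := by
    filter_upwards [hae] with ω hω
    have hωD : ω ∩ ↑D₁ = ω := Set.inter_eq_left.2 fun e he => by
      by_contra h'
      exact hω e h' he
    obtain ⟨i₀, hi₀⟩ := h.exists_sideA ω
    rw [hωD] at hi₀
    show (ω ∈ E) = (ω ∈ ⋃ i ∈ (Finset.univ.filter fun i : Fin 2 => Φ (sideA i)), atom (pmark a b c y v) (sideA i))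
    refine propext ⟨fun h' => ?_, fun h' => ?_⟩
    · exact Set.mem_iUnion₂.2 ⟨i₀, Finset.mem_filter.2 ⟨Finset.mem_univ _, (hE (isCanon_sideA i₀) hi₀).1 h'⟩, hi₀⟩
    · obtain ⟨i, hi, hωi⟩ := Set.mem_iUnion₂.1 h'
      exact (hE (isCanon_sideA i) hωi).2 (Finset.mem_filter.1 hi).2
  rw [measureReal_congr hcongr, measureReal_biUnion_finset ?_ (fun _ _ => MeasurableSet.of_discrete), Finset.sum_filter]
  intro i _ i' _ hne
  exact disjoint_atom _ (isCanon_sideA i) (isCanon_sideA i') fun h' => hne (sideA_injective h')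

/-- **Far-side dictionary**: under `w₂` every pattern event of the five marked points has measure `Σ_j [Φ (sideR j)] μ_{w₂}(atom pmark (sideR j))`. [this work] -/
theorem real_sideR_eq (h : IsPendantSplit D₁ D₂ w w₁ w₂ a b c y v) {E : Set (BondConfig (Fin n))} {Φ : (Fin 5 → Fin 5) → Prop}
    [DecidablePred Φ] (hE : HasPattern (pmark a b c y v) E Φ) :
    (prodBernoulli w₂).real E = ∑ j : Fin 15, if Φ (sideR j) then (prodBernoulli w₂).real (atom (pmark a b c y v) (sideR j)) else 0 := by
  classical
  have hae := prodBernoulli_ae_forall_notMem w₂ (Z := (↑D₂ : Set (Sym2 (Fin n)))ᶜ) (Set.to_countable _)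
    (fun e he => h.right_zero e (fun h' => he (Finset.mem_coe.2 h')))
  have hcongr : (E : Set (BondConfig (Fin n))) =ᵐ[prodBernoulli w₂]
      (⋃ j ∈ (Finset.univ.filter fun j : Fin 15 => Φ (sideR j)), atom (pmark a b c y v) (sideR j) : Set (BondConfig (Fin n))) := by
    filter_upwards [hae] with ω hω
    have hωD : ω ∩ ↑D₂ = ω := Set.inter_eq_left.2 fun e he => by
      by_contra h'
      exact hω e h' he
    obtain ⟨j₀, hj₀⟩ := h.exists_sideR ω
    rw [hωD] at hj₀
    show (ω ∈ E) = (ω ∈ ⋃ j ∈ (Finset.univ.filter fun j : Fin 15 => Φ (sideR j)), atom (pmark a b c y v) (sideR j))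
    refine propext ⟨fun h' => ?_, fun h' => ?_⟩
    · exact Set.mem_iUnion₂.2 ⟨j₀, Finset.mem_filter.2 ⟨Finset.mem_univ _, (hE (isCanon_sideR j₀) hj₀).1 h'⟩, hj₀⟩
    · obtain ⟨j, hj, hωj⟩ := Set.mem_iUnion₂.1 h'
      exact (hE (isCanon_sideR j) hωj).2 (Finset.mem_filter.1 hj).2
  rw [measureReal_congr hcongr, measureReal_biUnion_finset ?_ (fun _ _ => MeasurableSet.of_discrete), Finset.sum_filter]
  intro j _ j' _ hne
  exact disjoint_atom _ (isCanon_sideR j) (isCanon_sideR j') fun h' => hne (sideR_injective h')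

/-- `{x ↔ z}` for marked points `x = pmark s`, `z = pmark t` has pattern `π s = π t`. [folklore] -/
theorem oc5 (a b c y v : Fin n) (s t : Fin 5) {x z : Fin n} (hx : pmark a b c y v s = x) (hz : pmark a b c y v t = z) :
    HasPattern (pmark a b c y v) (openConn x z) fun π => π s = π t :=
  HasPattern.openConn_of_eq hx hz

/-! ## The pendant weight and the identification of the far-side law -/

/-- The two side-`a` masses sum to one: `μ_{w₁}(a ↮ v) + μ_{w₁}(a ↔ v) = 1`. [this work] -/
theorem sideA_sum (h : IsPendantSplit D₁ D₂ w w₁ w₂ a b c y v) : (prodBernoulli w₁).real (atom (pmark a b c y v) (sideA 0)) + (prodBernoulli w₁).real (atom (pmark a b c y v) (sideA 1)) = 1 := by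
  have this := h.real_sideA_eq (HasPattern.univ (p := pmark a b c y v))
  rw [probReal_univ] at this
  simp (config := {decide := true}) [Fin.sum_univ_two] at this
  linarith [this]

/-- `θ = μ_{w₁}(atom pmark (sideA 1))` is the probability that `a` is joined to the cut vertex inside its side. [this work] -/
theorem sideA_one_eq (h : IsPendantSplit D₁ D₂ w w₁ w₂ a b c y v) : (prodBernoulli w₁).real (atom (pmark a b c y v) (sideA 1)) = (prodBernoulli w₁).real (openConn a v) := by
  have this := h.real_sideA_eq (oc5 a b c y v 0 4 (x := a) (z := v) rfl rfl)
  simp (config := {decide := true}) [Fin.sum_univ_two] at this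
  linarith [this]

/-- The far piece's four-point atoms of `(v,b,c,y)` as pattern events of the five marked points. [folklore] -/
theorem hasPattern_atom_vbcy (a b c y v : Fin n) (k : Fin 15) :
    HasPattern (pmark a b c y v) (atom (quad v b c y) (pat4 k))
      (fun π => ∀ i j : Fin 4, π ((![4, 1, 2, 3] : Fin 4 → Fin 5) i) = π ((![4, 1, 2, 3] : Fin 4 → Fin 5) j) ↔ pat4 k i = pat4 k j) := by
  intro π _ ω hω
  simp only [mem_atom]
  have hq : ∀ i : Fin 4, quad v b c y i = pmark a b c y v ((![4, 1, 2, 3] : Fin 4 → Fin 5) i) := by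
    intro i; fin_cases i <;> rfl
  constructor
  · intro h' i j; rw [← hω, ← hq, ← hq]; exact h' i j
  · intro h' i j; rw [hq, hq, hω]; exact h' i j

/-- **The far-side law is the four-point law of `(v,b,c,y)` in the far piece**, cell `0`. [this work] -/
theorem sideR_eq_cell_0 (h : IsPendantSplit D₁ D₂ w w₁ w₂ a b c y v) : (prodBernoulli w₂).real (atom (pmark a b c y v) (sideR 0)) = cell w₂ v b c y 0 := by
  have this := h.real_sideR_eq (hasPattern_atom_vbcy a b c y v 0)
  unfold cell
  simp (config := {decide := true}) [Fin.sum_univ_succ] at this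
  linarith [this]

/-- **The far-side law is the four-point law of `(v,b,c,y)` in the far piece**, cell `1`. [this work] -/
theorem sideR_eq_cell_1 (h : IsPendantSplit D₁ D₂ w w₁ w₂ a b c y v) : (prodBernoulli w₂).real (atom (pmark a b c y v) (sideR 1)) = cell w₂ v b c y 1 := by
  have this := h.real_sideR_eq (hasPattern_atom_vbcy a b c y v 1)
  unfold cell
  simp (config := {decide := true}) [Fin.sum_univ_succ] at this
  linarith [this]

/-- **The far-side law is the four-point law of `(v,b,c,y)` in the far piece**, cell `2`. [this work] -/
theorem sideR_eq_cell_2 (h : IsPendantSplit D₁ D₂ w w₁ w₂ a b c y v) : (prodBernoulli w₂).real (atom (pmark a b c y v) (sideR 2)) = cell w₂ v b c y 2 := by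
  have this := h.real_sideR_eq (hasPattern_atom_vbcy a b c y v 2)
  unfold cell
  simp (config := {decide := true}) [Fin.sum_univ_succ] at this
  linarith [this]

/-- **The far-side law is the four-point law of `(v,b,c,y)` in the far piece**, cell `3`. [this work] -/
theorem sideR_eq_cell_3 (h : IsPendantSplit D₁ D₂ w w₁ w₂ a b c y v) : (prodBernoulli w₂).real (atom (pmark a b c y v) (sideR 3)) = cell w₂ v b c y 3 := by
  have this := h.real_sideR_eq (hasPattern_atom_vbcy a b c y v 3)
  unfold cell
  simp (config := {decide := true}) [Fin.sum_univ_succ] at this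
  linarith [this]

/-- **The far-side law is the four-point law of `(v,b,c,y)` in the far piece**, cell `4`. [this work] -/
theorem sideR_eq_cell_4 (h : IsPendantSplit D₁ D₂ w w₁ w₂ a b c y v) : (prodBernoulli w₂).real (atom (pmark a b c y v) (sideR 4)) = cell w₂ v b c y 4 := by
  have this := h.real_sideR_eq (hasPattern_atom_vbcy a b c y v 4)
  unfold cell
  simp (config := {decide := true}) [Fin.sum_univ_succ] at this
  linarith [this]

/-- **The far-side law is the four-point law of `(v,b,c,y)` in the far piece**, cell `5`. [this work] -/
theorem sideR_eq_cell_5 (h : IsPendantSplit D₁ D₂ w w₁ w₂ a b c y v) : (prodBernoulli w₂).real (atom (pmark a b c y v) (sideR 5)) = cell w₂ v b c y 5 := by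
  have this := h.real_sideR_eq (hasPattern_atom_vbcy a b c y v 5)
  unfold cell
  simp (config := {decide := true}) [Fin.sum_univ_succ] at this
  linarith [this]

/-- **The far-side law is the four-point law of `(v,b,c,y)` in the far piece**, cell `6`. [this work] -/
theorem sideR_eq_cell_6 (h : IsPendantSplit D₁ D₂ w w₁ w₂ a b c y v) : (prodBernoulli w₂).real (atom (pmark a b c y v) (sideR 6)) = cell w₂ v b c y 6 := by
  have this := h.real_sideR_eq (hasPattern_atom_vbcy a b c y v 6)
  unfold cell
  simp (config := {decide := true}) [Fin.sum_univ_succ] at this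
  linarith [this]

/-- **The far-side law is the four-point law of `(v,b,c,y)` in the far piece**, cell `7`. [this work] -/
theorem sideR_eq_cell_7 (h : IsPendantSplit D₁ D₂ w w₁ w₂ a b c y v) : (prodBernoulli w₂).real (atom (pmark a b c y v) (sideR 7)) = cell w₂ v b c y 7 := by
  have this := h.real_sideR_eq (hasPattern_atom_vbcy a b c y v 7)
  unfold cell
  simp (config := {decide := true}) [Fin.sum_univ_succ] at this
  linarith [this]

/-- **The far-side law is the four-point law of `(v,b,c,y)` in the far piece**, cell `8`. [this work] -/
theorem sideR_eq_cell_8 (h : IsPendantSplit D₁ D₂ w w₁ w₂ a b c y v) : (prodBernoulli w₂).real (atom (pmark a b c y v) (sideR 8)) = cell w₂ v b c y 8 := by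
  have this := h.real_sideR_eq (hasPattern_atom_vbcy a b c y v 8)
  unfold cell
  simp (config := {decide := true}) [Fin.sum_univ_succ] at this
  linarith [this]

/-- **The far-side law is the four-point law of `(v,b,c,y)` in the far piece**, cell `9`. [this work] -/
theorem sideR_eq_cell_9 (h : IsPendantSplit D₁ D₂ w w₁ w₂ a b c y v) : (prodBernoulli w₂).real (atom (pmark a b c y v) (sideR 9)) = cell w₂ v b c y 9 := by
  have this := h.real_sideR_eq (hasPattern_atom_vbcy a b c y v 9)
  unfold cell
  simp (config := {decide := true}) [Fin.sum_univ_succ] at this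
  linarith [this]

/-- **The far-side law is the four-point law of `(v,b,c,y)` in the far piece**, cell `10`. [this work] -/
theorem sideR_eq_cell_10 (h : IsPendantSplit D₁ D₂ w w₁ w₂ a b c y v) : (prodBernoulli w₂).real (atom (pmark a b c y v) (sideR 10)) = cell w₂ v b c y 10 := by
  have this := h.real_sideR_eq (hasPattern_atom_vbcy a b c y v 10)
  unfold cell
  simp (config := {decide := true}) [Fin.sum_univ_succ] at this
  linarith [this]

/-- **The far-side law is the four-point law of `(v,b,c,y)` in the far piece**, cell `11`. [this work] -/
theorem sideR_eq_cell_11 (h : IsPendantSplit D₁ D₂ w w₁ w₂ a b c y v) : (prodBernoulli w₂).real (atom (pmark a b c y v) (sideR 11)) = cell w₂ v b c y 11 := by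
  have this := h.real_sideR_eq (hasPattern_atom_vbcy a b c y v 11)
  unfold cell
  simp (config := {decide := true}) [Fin.sum_univ_succ] at this
  linarith [this]

/-- **The far-side law is the four-point law of `(v,b,c,y)` in the far piece**, cell `12`. [this work] -/
theorem sideR_eq_cell_12 (h : IsPendantSplit D₁ D₂ w w₁ w₂ a b c y v) : (prodBernoulli w₂).real (atom (pmark a b c y v) (sideR 12)) = cell w₂ v b c y 12 := by
  have this := h.real_sideR_eq (hasPattern_atom_vbcy a b c y v 12)
  unfold cell
  simp (config := {decide := true}) [Fin.sum_univ_succ] at this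
  linarith [this]

/-- **The far-side law is the four-point law of `(v,b,c,y)` in the far piece**, cell `13`. [this work] -/
theorem sideR_eq_cell_13 (h : IsPendantSplit D₁ D₂ w w₁ w₂ a b c y v) : (prodBernoulli w₂).real (atom (pmark a b c y v) (sideR 13)) = cell w₂ v b c y 13 := by
  have this := h.real_sideR_eq (hasPattern_atom_vbcy a b c y v 13)
  unfold cell
  simp (config := {decide := true}) [Fin.sum_univ_succ] at this
  linarith [this]

/-- **The far-side law is the four-point law of `(v,b,c,y)` in the far piece**, cell `14`. [this work] -/
theorem sideR_eq_cell_14 (h : IsPendantSplit D₁ D₂ w w₁ w₂ a b c y v) : (prodBernoulli w₂).real (atom (pmark a b c y v) (sideR 14)) = cell w₂ v b c y 14 := by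
  have this := h.real_sideR_eq (hasPattern_atom_vbcy a b c y v 14)
  unfold cell
  simp (config := {decide := true}) [Fin.sum_univ_succ] at this
  linarith [this]

/-! ## The pendant substitution: the fifteen cells -/

/-- Cell `0` (`a|b|c|y`) of the glued weighting: the pendant substitution (`θ = μ_{w₁}(a ↔ v)`, far cells `d_j = cell w₂ v b c y j`). [this work] -/
theorem cell0 (h : IsPendantSplit D₁ D₂ w w₁ w₂ a b c y v) :
    cell w a b c y 0 = (prodBernoulli w₁).real (atom (pmark a b c y v) (sideA 0)) * (cell w₂ v b c y 0 + cell w₂ v b c y 4 + cell w₂ v b c y 5 + cell w₂ v b c y 6) + (prodBernoulli w₁).real (atom (pmark a b c y v) (sideA 1)) * cell w₂ v b c y 0 := by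
  have H := h.cell_eq_sum 0
  simp (config := {decide := true}) [Fin.sum_univ_succ] at H
  rw [← h.sideR_eq_cell_0, ← h.sideR_eq_cell_4, ← h.sideR_eq_cell_5, ← h.sideR_eq_cell_6]
  linarith [H]

/-- Cell `1` (`a|b|cy`) of the glued weighting: the pendant substitution (`θ = μ_{w₁}(a ↔ v)`, far cells `d_j = cell w₂ v b c y j`). [this work] -/
theorem cell1 (h : IsPendantSplit D₁ D₂ w w₁ w₂ a b c y v) :
    cell w a b c y 1 = (prodBernoulli w₁).real (atom (pmark a b c y v) (sideA 0)) * (cell w₂ v b c y 1 + cell w₂ v b c y 10 + cell w₂ v b c y 11) + (prodBernoulli w₁).real (atom (pmark a b c y v) (sideA 1)) * cell w₂ v b c y 1 := by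
  have H := h.cell_eq_sum 1
  simp (config := {decide := true}) [Fin.sum_univ_succ] at H
  rw [← h.sideR_eq_cell_1, ← h.sideR_eq_cell_10, ← h.sideR_eq_cell_11]
  linarith [H]

/-- Cell `2` (`a|by|c`) of the glued weighting: the pendant substitution (`θ = μ_{w₁}(a ↔ v)`, far cells `d_j = cell w₂ v b c y j`). [this work] -/
theorem cell2 (h : IsPendantSplit D₁ D₂ w w₁ w₂ a b c y v) :
    cell w a b c y 2 = (prodBernoulli w₁).real (atom (pmark a b c y v) (sideA 0)) * (cell w₂ v b c y 2 + cell w₂ v b c y 9 + cell w₂ v b c y 12) + (prodBernoulli w₁).real (atom (pmark a b c y v) (sideA 1)) * cell w₂ v b c y 2 := by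
  have H := h.cell_eq_sum 2
  simp (config := {decide := true}) [Fin.sum_univ_succ] at H
  rw [← h.sideR_eq_cell_2, ← h.sideR_eq_cell_9, ← h.sideR_eq_cell_12]
  linarith [H]

/-- Cell `3` (`a|bc|y`) of the glued weighting: the pendant substitution (`θ = μ_{w₁}(a ↔ v)`, far cells `d_j = cell w₂ v b c y j`). [this work] -/
theorem cell3 (h : IsPendantSplit D₁ D₂ w w₁ w₂ a b c y v) :
    cell w a b c y 3 = (prodBernoulli w₁).real (atom (pmark a b c y v) (sideA 0)) * (cell w₂ v b c y 3 + cell w₂ v b c y 8 + cell w₂ v b c y 13) + (prodBernoulli w₁).real (atom (pmark a b c y v) (sideA 1)) * cell w₂ v b c y 3 := by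
  have H := h.cell_eq_sum 3
  simp (config := {decide := true}) [Fin.sum_univ_succ] at H
  rw [← h.sideR_eq_cell_3, ← h.sideR_eq_cell_8, ← h.sideR_eq_cell_13]
  linarith [H]

/-- Cell `4` (`ay|b|c`) of the glued weighting: the pendant substitution (`θ = μ_{w₁}(a ↔ v)`, far cells `d_j = cell w₂ v b c y j`). [this work] -/
theorem cell4 (h : IsPendantSplit D₁ D₂ w w₁ w₂ a b c y v) :
    cell w a b c y 4 = (prodBernoulli w₁).real (atom (pmark a b c y v) (sideA 1)) * cell w₂ v b c y 4 := by
  have H := h.cell_eq_sum 4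
  simp (config := {decide := true}) [Fin.sum_univ_succ] at H
  rw [← h.sideR_eq_cell_4]
  linarith [H]

/-- Cell `5` (`ac|b|y`) of the glued weighting: the pendant substitution (`θ = μ_{w₁}(a ↔ v)`, far cells `d_j = cell w₂ v b c y j`). [this work] -/
theorem cell5 (h : IsPendantSplit D₁ D₂ w w₁ w₂ a b c y v) :
    cell w a b c y 5 = (prodBernoulli w₁).real (atom (pmark a b c y v) (sideA 1)) * cell w₂ v b c y 5 := by
  have H := h.cell_eq_sum 5
  simp (config := {decide := true}) [Fin.sum_univ_succ] at H
  rw [← h.sideR_eq_cell_5]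
  linarith [H]

/-- Cell `6` (`ab|c|y`) of the glued weighting: the pendant substitution (`θ = μ_{w₁}(a ↔ v)`, far cells `d_j = cell w₂ v b c y j`). [this work] -/
theorem cell6 (h : IsPendantSplit D₁ D₂ w w₁ w₂ a b c y v) :
    cell w a b c y 6 = (prodBernoulli w₁).real (atom (pmark a b c y v) (sideA 1)) * cell w₂ v b c y 6 := by
  have H := h.cell_eq_sum 6
  simp (config := {decide := true}) [Fin.sum_univ_succ] at H
  rw [← h.sideR_eq_cell_6]
  linarith [H]

/-- Cell `7` (`a|bcy`) of the glued weighting: the pendant substitution (`θ = μ_{w₁}(a ↔ v)`, far cells `d_j = cell w₂ v b c y j`). [this work] -/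
theorem cell7 (h : IsPendantSplit D₁ D₂ w w₁ w₂ a b c y v) :
    cell w a b c y 7 = (prodBernoulli w₁).real (atom (pmark a b c y v) (sideA 0)) * (cell w₂ v b c y 7 + cell w₂ v b c y 14) + (prodBernoulli w₁).real (atom (pmark a b c y v) (sideA 1)) * cell w₂ v b c y 7 := by
  have H := h.cell_eq_sum 7
  simp (config := {decide := true}) [Fin.sum_univ_succ] at H
  rw [← h.sideR_eq_cell_7, ← h.sideR_eq_cell_14]
  linarith [H]

/-- Cell `8` (`ay|bc`) of the glued weighting: the pendant substitution (`θ = μ_{w₁}(a ↔ v)`, far cells `d_j = cell w₂ v b c y j`). [this work] -/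
theorem cell8 (h : IsPendantSplit D₁ D₂ w w₁ w₂ a b c y v) :
    cell w a b c y 8 = (prodBernoulli w₁).real (atom (pmark a b c y v) (sideA 1)) * cell w₂ v b c y 8 := by
  have H := h.cell_eq_sum 8
  simp (config := {decide := true}) [Fin.sum_univ_succ] at H
  rw [← h.sideR_eq_cell_8]
  linarith [H]

/-- Cell `9` (`ac|by`) of the glued weighting: the pendant substitution (`θ = μ_{w₁}(a ↔ v)`, far cells `d_j = cell w₂ v b c y j`). [this work] -/
theorem cell9 (h : IsPendantSplit D₁ D₂ w w₁ w₂ a b c y v) :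
    cell w a b c y 9 = (prodBernoulli w₁).real (atom (pmark a b c y v) (sideA 1)) * cell w₂ v b c y 9 := by
  have H := h.cell_eq_sum 9
  simp (config := {decide := true}) [Fin.sum_univ_succ] at H
  rw [← h.sideR_eq_cell_9]
  linarith [H]

/-- Cell `10` (`acy|b`) of the glued weighting: the pendant substitution (`θ = μ_{w₁}(a ↔ v)`, far cells `d_j = cell w₂ v b c y j`). [this work] -/
theorem cell10 (h : IsPendantSplit D₁ D₂ w w₁ w₂ a b c y v) :
    cell w a b c y 10 = (prodBernoulli w₁).real (atom (pmark a b c y v) (sideA 1)) * cell w₂ v b c y 10 := by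
  have H := h.cell_eq_sum 10
  simp (config := {decide := true}) [Fin.sum_univ_succ] at H
  rw [← h.sideR_eq_cell_10]
  linarith [H]

/-- Cell `11` (`ab|cy`) of the glued weighting: the pendant substitution (`θ = μ_{w₁}(a ↔ v)`, far cells `d_j = cell w₂ v b c y j`). [this work] -/
theorem cell11 (h : IsPendantSplit D₁ D₂ w w₁ w₂ a b c y v) :
    cell w a b c y 11 = (prodBernoulli w₁).real (atom (pmark a b c y v) (sideA 1)) * cell w₂ v b c y 11 := by
  have H := h.cell_eq_sum 11
  simp (config := {decide := true}) [Fin.sum_univ_succ] at H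
  rw [← h.sideR_eq_cell_11]
  linarith [H]

/-- Cell `12` (`aby|c`) of the glued weighting: the pendant substitution (`θ = μ_{w₁}(a ↔ v)`, far cells `d_j = cell w₂ v b c y j`). [this work] -/
theorem cell12 (h : IsPendantSplit D₁ D₂ w w₁ w₂ a b c y v) :
    cell w a b c y 12 = (prodBernoulli w₁).real (atom (pmark a b c y v) (sideA 1)) * cell w₂ v b c y 12 := by
  have H := h.cell_eq_sum 12
  simp (config := {decide := true}) [Fin.sum_univ_succ] at H
  rw [← h.sideR_eq_cell_12]
  linarith [H]

/-- Cell `13` (`abc|y`) of the glued weighting: the pendant substitution (`θ = μ_{w₁}(a ↔ v)`, far cells `d_j = cell w₂ v b c y j`). [this work] -/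
theorem cell13 (h : IsPendantSplit D₁ D₂ w w₁ w₂ a b c y v) :
    cell w a b c y 13 = (prodBernoulli w₁).real (atom (pmark a b c y v) (sideA 1)) * cell w₂ v b c y 13 := by
  have H := h.cell_eq_sum 13
  simp (config := {decide := true}) [Fin.sum_univ_succ] at H
  rw [← h.sideR_eq_cell_13]
  linarith [H]

/-- Cell `14` (`abcy`) of the glued weighting: the pendant substitution (`θ = μ_{w₁}(a ↔ v)`, far cells `d_j = cell w₂ v b c y j`). [this work] -/
theorem cell14 (h : IsPendantSplit D₁ D₂ w w₁ w₂ a b c y v) :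
    cell w a b c y 14 = (prodBernoulli w₁).real (atom (pmark a b c y v) (sideA 1)) * cell w₂ v b c y 14 := by
  have H := h.cell_eq_sum 14
  simp (config := {decide := true}) [Fin.sum_univ_succ] at H
  rw [← h.sideR_eq_cell_14]
  linarith [H]

end IsPendantSplit

end FourPointPendantSide

end Summit.CriticalPhenomena.PercolationContinuityZ3.Theorems
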